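import Summits.ValiantsHypothesis.ValiantsHypothesis.Theses.NewtonUnitEquations
import Literature.Computability.AlgebraicComplexity.NewtonPolygonTauTransfer

/-!
# `TwoProducts` (stmt-ValiantsHypothesis-5906) — negative side: load-bearing hypotheses and parameters

Standing disprover (cdisprove, cycle 1), extracted from `Cruxes/TwoProducts/Disproof.lean` §1–§2.
The crux: `∃ a b, ∀ m t (f g : Fin m → ℂ[X,Y])` `t`-sparse, `#vert Newt(∏ f − ∏ g) ≤ 2^(a·m)·(t+2)^b`.
Any proof must use BOTH sparsity hypotheses and the bound genuinely needs BOTH parameters: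

* `twoProducts_false_without_sparsityG` / `…F` — the crux with the sparsity of one product DELETED is FALSE (`m = 1`, `t = 0`,
  the other product is KPTT's parabola polynomial `F_n` with `2^n` vertices, `KPTT.newtonVertexCount_kpttPoly`).
* `not_twoProductsBoundFreeOfT` — no bound of shape `2^(a·m)` alone (`m = 1`, `f₀ = F_n`, `g₀ = 0`).
* `not_twoProductsBoundFreeOfM` — no bound of shape `(t+2)^b` alone: the finite `q`-Pochhammer product
  `Q_n = ∏_{j<n} (1 + X·Y^j)` of `n` BINOMIALS has the `n+1` parabola points `(k, k(k-1)/2)` among its hull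
  vertices (`le_vert_qPoch`; support shape `support_qPoch`, parabola coefficients `coeff_qPoch_parabola`,
  strict exposure `expo_lt`) — a certified Ostrowski-tight family, reusable as a `t = 2` lower-bound witness.

Elementary; the refuted variants are stated inline (no `def … : Prop`); the remaining `def`s are the witness
family's data (`T`, `ex`, `qFactor`, `qPoch`, `parabPt`, `expo`) and the crux's count `vert`/`ι`. [folklore]
-/

set_option linter.dupNamespace false

namespace Summit.ValiantsHypothesis.ValiantsHypothesis.Theorems.TwoProducts.Negative

open scoped BigOperators
open MvPolynomial Literature.Computability.AlgebraicComplexity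

noncomputable section


/-- The planar point of an exponent vector, exactly as inlined in the crux. [folklore] -/
abbrev ι : (Fin 2 →₀ ℕ) → (Fin 2 → ℝ) := fun e i => ((e i : ℕ) : ℝ)

/-- The vertex count of the crux, as a function of the polynomial (definitionally `newtonVertexCount`). [folklore] -/
abbrev vert (W : MvPolynomial (Fin 2) ℂ) : ℕ :=
  (Set.extremePoints ℝ (convexHull ℝ (ι '' (W.support : Set (Fin 2 →₀ ℕ))))).ncard

/-- Sanity: the crux is literally the `vert`-bound for the difference of the two products. [folklore] -/
theorem twoProducts_iff :
    Theses.NewtonUnitEquations.TwoProducts ↔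
      ∃ a b : ℕ, ∀ (m t : ℕ) (f g : Fin m → MvPolynomial (Fin 2) ℂ), (∀ j, (f j).support.card ≤ t) →
        (∀ j, (g j).support.card ≤ t) → vert (∏ j, f j - ∏ j, g j) ≤ 2 ^ (a * m) * (t + 2) ^ b :=
  Iff.rfl

/-- `vert` is the Literature abbreviation `newtonVertexCount`. [folklore] -/
theorem vert_eq (W : MvPolynomial (Fin 2) ℂ) : vert W = newtonVertexCount W := rfl

/-! ## §1  Load-bearing hypotheses: sparsity of BOTH products, and the `t`-dependence of the bound -/

/-- `2^(a+b) < 2^(a+b+1)`, the arithmetic of all the parabola witnesses. [folklore] -/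
theorem pow_witness_lt (a b : ℕ) : 2 ^ (a * 1) * (0 + 2) ^ b < 2 ^ (a + b + 1) := by
  rw [mul_one, zero_add, ← pow_add]
  exact Nat.pow_lt_pow_right (by norm_num) (by omega)

/-- **Any proof must use the sparsity of `g`**: with `m = 1`, `t = 0`, `f₀ = 0`, `g₀ = −F_n` (KPTT's parabola
polynomial, `2^n` vertices) the difference is `F_n`. [folklore] -/
theorem twoProducts_false_without_sparsityG :
    ¬ ∃ a b : ℕ, ∀ (m t : ℕ) (f g : Fin m → MvPolynomial (Fin 2) ℂ), (∀ j, (f j).support.card ≤ t) →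
      vert (∏ j, f j - ∏ j, g j) ≤ 2 ^ (a * m) * (t + 2) ^ b := by
  rintro ⟨a, b, h⟩
  have key := h 1 0 (fun _ => 0) (fun _ => -KPTT.kpttPoly (a + b + 1)) (fun _ => by simp)
  simp only [Fin.prod_univ_one, zero_sub, neg_neg] at key
  change newtonVertexCount (KPTT.kpttPoly (a + b + 1)) ≤ _ at key
  rw [KPTT.newtonVertexCount_kpttPoly] at key
  exact absurd (pow_witness_lt a b) (not_lt.2 key)

/-- **Any proof must use the sparsity of `f`** (symmetric witness `f₀ = F_n`, `g₀ = 0`). [folklore] -/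
theorem twoProducts_false_without_sparsityF :
    ¬ ∃ a b : ℕ, ∀ (m t : ℕ) (f g : Fin m → MvPolynomial (Fin 2) ℂ), (∀ j, (g j).support.card ≤ t) →
      vert (∏ j, f j - ∏ j, g j) ≤ 2 ^ (a * m) * (t + 2) ^ b := by
  rintro ⟨a, b, h⟩
  have key := h 1 0 (fun _ => KPTT.kpttPoly (a + b + 1)) (fun _ => 0) (fun _ => by simp)
  simp only [Fin.prod_univ_one, sub_zero] at key
  change newtonVertexCount (KPTT.kpttPoly (a + b + 1)) ≤ _ at key
  rw [KPTT.newtonVertexCount_kpttPoly] at key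
  exact absurd (pow_witness_lt a b) (not_lt.2 key)

/-- The support of KPTT's `F_n` has exactly `2^n` monomials. [cite: KoiranPortierTavenasThomasse2015, §3] -/
theorem card_support_kpttPoly (n : ℕ) : (KPTT.kpttPoly n).support.card = 2 ^ n := by
  rw [KPTT.support_kpttPoly, Finset.card_image_of_injective _ (KPTT.kpttExp_injective n), Finset.card_range]

/-- NATURAL STRENGTHENING REFUTED: the bound cannot be free of `t` (shape `2^(a·m)` alone): one `2^n`-sparse factor
`F_n` against `0` has `2^n > 2^a` vertices. [folklore] -/
theorem not_twoProductsBoundFreeOfT :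
    ¬ ∃ a : ℕ, ∀ (m t : ℕ) (f g : Fin m → MvPolynomial (Fin 2) ℂ), (∀ j, (f j).support.card ≤ t) →
      (∀ j, (g j).support.card ≤ t) → vert (∏ j, f j - ∏ j, g j) ≤ 2 ^ (a * m) := by
  rintro ⟨a, h⟩
  have key := h 1 (2 ^ (a + 1)) (fun _ => KPTT.kpttPoly (a + 1)) (fun _ => 0)
    (fun _ => (card_support_kpttPoly (a + 1)).le) (fun _ => by simp)
  simp only [Fin.prod_univ_one, sub_zero, mul_one] at key
  change newtonVertexCount (KPTT.kpttPoly (a + 1)) ≤ _ at key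
  rw [KPTT.newtonVertexCount_kpttPoly] at key
  exact absurd (Nat.pow_lt_pow_right (by norm_num) (Nat.lt_succ_self a)) (not_lt.2 key)

/-! ## §2  The `m`-dependence is load-bearing too: a certified Ostrowski-tight family with `t = 2`

`Q_n = ∏_{j<n} (1 + X·Y^j)` (a finite `q`-Pochhammer symbol).  Every exponent `(k, s)` in its support has `k ≤ n`
and `s ≥ T k = k(k-1)/2`, and `(k, T k)` occurs with coefficient `1` (`k ≤ n`); the `n+1` parabola points
`(k, T k)` are strictly exposed by `(x,y) ↦ (k - 1/2)x - y`, hence hull vertices.  So `vert Q_n ≥ n + 1` with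
2-sparse factors, and no bound of the shape `(t+2)^b` can hold. -/

/-- Triangular numbers `T k = k(k-1)/2`, by recursion (`T (k+1) = T k + k`). [folklore] -/
def T : ℕ → ℕ
  | 0 => 0
  | k + 1 => T k + k

/-- `T 0 = 0`. [folklore] -/
@[simp] theorem T_zero : T 0 = 0 := rfl

/-- `T (k+1) = T k + k`. [folklore] -/
@[simp] theorem T_succ (k : ℕ) : T (k + 1) = T k + k := rfl

/-- `2·T k = k² - k` over `ℝ`. [folklore] -/
theorem two_mul_T (k : ℕ) : (2 : ℝ) * (T k : ℝ) = (k : ℝ) * k - k := by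
  induction k with
  | zero => simp
  | succ k ih => rw [T_succ]; push_cast; nlinarith [ih]

/-- `T` is monotone in the step form we need: `T k + k ≤ T (k + 1)` and hence `T a ≤ T b` for `a ≤ b`. [folklore] -/
theorem T_mono {a b : ℕ} (h : a ≤ b) : T a ≤ T b := by
  induction h with
  | refl => exact le_rfl
  | step _ ih => exact ih.trans (by rw [T_succ]; omega)

/-- The exponent vector `(k, s)`. [folklore] -/
def ex (k s : ℕ) : Fin 2 →₀ ℕ := Finsupp.single 0 k + Finsupp.single 1 s

/-- First coordinate of `ex k s`. [folklore] -/
@[simp] theorem ex_apply_zero (k s : ℕ) : ex k s 0 = k := by simp [ex]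

/-- Second coordinate of `ex k s`. [folklore] -/
@[simp] theorem ex_apply_one (k s : ℕ) : ex k s 1 = s := by simp [ex]

/-- `ex` is additive. [folklore] -/
theorem ex_add (a b c d : ℕ) : ex a b + ex c d = ex (a + c) (b + d) := by
  ext i; fin_cases i <;> simp

/-- Componentwise order on `ex`. [folklore] -/
theorem ex_le_iff (a b c d : ℕ) : ex a b ≤ ex c d ↔ a ≤ c ∧ b ≤ d := by
  rw [Finsupp.le_def, Fin.forall_fin_two, ex_apply_zero, ex_apply_zero, ex_apply_one, ex_apply_one]

/-- Every exponent vector is an `ex`. [folklore] -/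
theorem ex_eq (e : Fin 2 →₀ ℕ) : e = ex (e 0) (e 1) := by
  ext i; fin_cases i <;> simp

/-- `ex` is injective in both arguments. [folklore] -/
theorem ex_injective2 {a b c d : ℕ} (h : ex a b = ex c d) : a = c ∧ b = d :=
  ⟨by simpa using congrArg (fun e => e 0) h, by simpa using congrArg (fun e => e 1) h⟩

/-- The binomial factor `1 + X·Y^j`. [folklore] -/
def qFactor (j : ℕ) : MvPolynomial (Fin 2) ℂ := 1 + monomial (ex 1 j) 1

/-- `Q_n = ∏_{j<n} (1 + X·Y^j)`. [folklore] -/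
def qPoch (n : ℕ) : MvPolynomial (Fin 2) ℂ := ∏ j ∈ Finset.range n, qFactor j

/-- The defining recursion `Q_{n+1} = Q_n + Q_n·X·Y^n`. [folklore] -/
theorem qPoch_succ (n : ℕ) : qPoch (n + 1) = qPoch n + qPoch n * monomial (ex 1 n) 1 := by
  rw [qPoch, Finset.prod_range_succ, ← qPoch, qFactor, mul_add, mul_one]

/-- Each factor is 2-sparse. [folklore] -/
theorem card_support_qFactor (j : ℕ) : (qFactor j).support.card ≤ 2 := by
  classical
  unfold qFactor
  calc (1 + monomial (ex 1 j) (1 : ℂ)).support.card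
      ≤ ((1 : MvPolynomial (Fin 2) ℂ).support ∪ (monomial (ex 1 j) (1 : ℂ)).support).card :=
        Finset.card_le_card support_add
    _ ≤ (1 : MvPolynomial (Fin 2) ℂ).support.card + (monomial (ex 1 j) (1 : ℂ)).support.card :=
        Finset.card_union_le _ _
    _ ≤ 1 + 1 := Nat.add_le_add (by rw [support_one, Finset.card_singleton])
        ((Finset.card_le_card support_monomial_subset).trans (by rw [Finset.card_singleton]))

/-- SUPPORT SHAPE: every monomial `X^k Y^s` of `Q_n` has `k ≤ n` and `s ≥ T k`. [folklore] -/
theorem support_qPoch (n : ℕ) : ∀ e ∈ (qPoch n).support, e 0 ≤ n ∧ T (e 0) ≤ e 1 := by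
  classical
  induction n with
  | zero =>
    intro e he
    rw [qPoch, Finset.range_zero, Finset.prod_empty, support_one, Finset.mem_singleton] at he
    subst he; simp
  | succ n ih =>
    intro e he
    rw [qPoch_succ] at he
    rcases Finset.mem_union.1 (support_add he) with h | h
    · obtain ⟨h1, h2⟩ := ih e h
      exact ⟨Nat.le_succ_of_le h1, h2⟩
    · obtain ⟨a, ha, b, hb, rfl⟩ := Finset.mem_add.1 (support_mul _ _ h)
      have hb' : b = ex 1 n := Finset.mem_singleton.1 (support_monomial_subset hb)
      subst hb'
      obtain ⟨h1, h2⟩ := ih a ha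
      refine ⟨?_, ?_⟩
      · simp only [Finsupp.coe_add, Pi.add_apply, ex_apply_zero]; omega
      · simp only [Finsupp.coe_add, Pi.add_apply, ex_apply_zero, ex_apply_one, T_succ]; omega

/-- PARABOLA POINTS PRESENT: the coefficient of `X^k Y^{T k}` in `Q_n` is `1` for `k ≤ n`
(the unique way is to pick `X·Y^j` from the factors `j < k`). [folklore] -/
theorem coeff_qPoch_parabola (n : ℕ) : ∀ k ≤ n, coeff (ex k (T k)) (qPoch n) = 1 := by
  classical
  induction n with
  | zero =>
    intro k hk
    obtain rfl : k = 0 := Nat.le_zero.1 hk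
    rw [qPoch, Finset.range_zero, Finset.prod_empty]
    simp [ex]
  | succ n ih =>
    intro k hk
    rw [qPoch_succ, coeff_add, coeff_mul_monomial', mul_one]
    rcases Nat.lt_or_ge n k with hlt | hle
    · -- k = n + 1: the first summand vanishes, the second is the parabola point of level n
      obtain rfl : k = n + 1 := le_antisymm hk hlt
      have h0 : coeff (ex (n + 1) (T (n + 1))) (qPoch n) = 0 := by
        rw [← notMem_support_iff]
        intro hmem
        have := (support_qPoch n _ hmem).1
        simp at this
      have hle' : ex 1 n ≤ ex (n + 1) (T (n + 1)) := by rw [ex_le_iff, T_succ]; omega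
      have hsub : ex (n + 1) (T (n + 1)) - ex 1 n = ex n (T n) := by
        apply tsub_eq_of_eq_add; rw [ex_add, T_succ]
      rw [h0, if_pos hle', hsub, ih n le_rfl, zero_add]
    · -- k ≤ n: the first summand is 1, the second vanishes
      rw [ih k hle]
      split_ifs with hle'
      · rw [ex_le_iff] at hle'
        have hsub : ex k (T k) - ex 1 n = ex (k - 1) (T k - n) := by
          apply tsub_eq_of_eq_add; rw [ex_add]; congr 1 <;> omega
        have h0 : coeff (ex (k - 1) (T k - n)) (qPoch n) = 0 := by
          rw [← notMem_support_iff]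
          intro hmem
          have h := (support_qPoch n _ hmem).2
          simp only [ex_apply_zero, ex_apply_one] at h
          -- T (k-1) ≤ T k - n with T k = T (k-1) + (k-1) forces n ≤ k - 1 < k ≤ n
          obtain ⟨k', rfl⟩ : ∃ k', k = k' + 1 := ⟨k - 1, by omega⟩
          simp only [Nat.add_sub_cancel, T_succ] at h hle' hle
          omega
        rw [hsub, h0, add_zero]
      · rw [add_zero]

/-- The planar parabola point `(k, T k)`. [folklore] -/
def parabPt (k : ℕ) : Fin 2 → ℝ := ι (ex k (T k))

/-- First coordinate of the parabola point. [folklore] -/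
@[simp] theorem parabPt_zero (k : ℕ) : parabPt k 0 = k := by simp [parabPt, ι]

/-- Second coordinate of the parabola point. [folklore] -/
@[simp] theorem parabPt_one (k : ℕ) : parabPt k 1 = T k := by simp [parabPt, ι]

/-- The parabola points are pairwise distinct. [folklore] -/
theorem parabPt_injective : Function.Injective parabPt := fun a b h => by
  have := congrArg (fun q => q 0) h
  simpa using this

/-- The exposing functional at level `k`: `(x, y) ↦ (k - 1/2)·x - y`. [folklore] -/
def expo (k : ℕ) : (Fin 2 → ℝ) →ₗ[ℝ] ℝ :=
  ((k : ℝ) - 1 / 2) • LinearMap.proj 0 - LinearMap.proj 1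

/-- The exposing functional, evaluated. [folklore] -/
@[simp] theorem expo_apply (k : ℕ) (q : Fin 2 → ℝ) : expo k q = ((k : ℝ) - 1 / 2) * q 0 - q 1 := by
  simp [expo]

/-- STRICT EXPOSURE: on the support of `Q_n`, `expo k` is uniquely maximised at `(k, T k)`
(`expo k (k, T k) - expo k (x, y) ≥ (k - x)²/2`, with equality only if `y = T x`). [folklore] -/
theorem expo_lt (n k : ℕ) {e : Fin 2 →₀ ℕ} (he : e ∈ (qPoch n).support) (hne : ι e ≠ parabPt k) :
    expo k (ι e) < expo k (parabPt k) := by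
  obtain ⟨-, hT⟩ := support_qPoch n e he
  have hT' : (T (e 0) : ℝ) ≤ (e 1 : ℝ) := by exact_mod_cast hT
  have h2e := two_mul_T (e 0)
  have h2k := two_mul_T k
  simp only [expo_apply, parabPt_zero, parabPt_one]
  simp only [ι]
  by_cases hx : e 0 = k
  · -- same column: then e 1 > T k (else the points coincide)
    have hy : e 1 ≠ T k := by
      intro hy
      apply hne
      rw [ex_eq e, hx, hy]; rfl
    have hlt : (T k : ℝ) < (e 1 : ℝ) := by
      rw [hx] at hT
      exact_mod_cast lt_of_le_of_ne hT (Ne.symm hy)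
    rw [hx] at h2e ⊢
    linarith
  · have hsq : (0 : ℝ) < ((e 0 : ℝ) - k) ^ 2 := by
      have : (e 0 : ℝ) - k ≠ 0 := sub_ne_zero.2 (by exact_mod_cast hx)
      positivity
    nlinarith

/-- **`Q_n` has at least `n + 1` hull vertices** (the lower parabola; in fact exactly `2n` for `n ≥ 2`). [folklore] -/
theorem le_vert_qPoch (n : ℕ) : n + 1 ≤ vert (qPoch n) := by
  classical
  set S : Set (Fin 2 → ℝ) := ι '' ((qPoch n).support : Set (Fin 2 →₀ ℕ)) with hS
  have hfin : ((convexHull ℝ S).extremePoints ℝ).Finite :=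
    (Set.Finite.image ι (Finset.finite_toSet _)).subset extremePoints_convexHull_subset
  have hsub : parabPt '' (Finset.range (n + 1) : Set ℕ) ⊆ (convexHull ℝ S).extremePoints ℝ := by
    rintro p ⟨k, hk, rfl⟩
    have hk' : k ≤ n := Nat.lt_succ_iff.1 (Finset.mem_range.1 (Finset.mem_coe.1 hk))
    have hp : parabPt k ∈ S := ⟨ex k (T k), by
      rw [Finset.mem_coe, mem_support_iff, coeff_qPoch_parabola n k hk']; exact one_ne_zero, rfl⟩
    refine KPTT.mem_extremePoints_convexHull_of_linear hp (expo k) ?_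
    rintro q ⟨e, he, rfl⟩ hne
    exact expo_lt n k (Finset.mem_coe.1 he) hne
  calc n + 1 = (parabPt '' (Finset.range (n + 1) : Set ℕ)).ncard := by
        rw [Set.ncard_image_of_injective _ parabPt_injective, Set.ncard_coe_finset, Finset.card_range]
    _ ≤ ((convexHull ℝ S).extremePoints ℝ).ncard := Set.ncard_le_ncard hsub hfin

/-- NATURAL STRENGTHENING REFUTED: the bound cannot be free of `m` (shape `(t+2)^b` alone, i.e. "polynomial in
`t` uniformly in the number of factors"): `Q_n` with `n = 4^b` binomial factors against `0` has `> 4^b` vertices.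
[folklore] -/
theorem not_twoProductsBoundFreeOfM :
    ¬ ∃ b : ℕ, ∀ (m t : ℕ) (f g : Fin m → MvPolynomial (Fin 2) ℂ), (∀ j, (f j).support.card ≤ t) →
      (∀ j, (g j).support.card ≤ t) → vert (∏ j, f j - ∏ j, g j) ≤ (t + 2) ^ b := by
  rintro ⟨b, h⟩
  set n : ℕ := 4 ^ b with hn
  have hn1 : 1 ≤ n := Nat.one_le_pow _ _ (by norm_num)
  have key := h n 2 (fun j => qFactor j) (fun _ => 0) (fun j => card_support_qFactor j) (fun _ => by simp)
  have hprod : (∏ j : Fin n, qFactor j) = qPoch n := by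
    rw [qPoch, ← Fin.prod_univ_eq_prod_range]
  have hzero : (∏ _j : Fin n, (0 : MvPolynomial (Fin 2) ℂ)) = 0 :=
    Finset.prod_eq_zero (Finset.mem_univ (⟨0, hn1⟩ : Fin n)) rfl
  rw [hprod, hzero, sub_zero] at key
  have hv := le_vert_qPoch n
  have h4 : (2 + 2) ^ b = n := by rw [hn]
  omega


end

end Summit.ValiantsHypothesis.ValiantsHypothesis.Theorems.TwoProducts.Negative
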